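import Mathlib
import Summits.ValiantsHypothesis.ValiantsHypothesis.Theorems.BarrierLeverDefinableEquationsProductDepthWallTwoPeel

/-!
# Route BarrierLever — crux `DefinableEquations` (stmt-8745) / item `SingleSizeEquations`
# (stmt-8749): every sign count admits a word with a MERGE-ORDERED PREFIX and a FREE TAIL
# (val-np-p5 g15, part 4 of `…ProductDepthWallTwo*`)

§7 For LST's two-letter words (letters `⌊k/√2⌋` for positive, `k` for negative blocks) and all
counts `p + q = n` there is a word on `n` blocks with `p` positive ones whose blocks form a prefix in
merge position (each appended to the shorter-or-equal stream, letters `≥ 1`) followed by free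
blocks (each on the longer-or-equal side, or without bits) — `exists_mergeWord`, by the backward
greedy construction (peel a free block if there is one, otherwise the block with the larger start,
both on a tie), a strong induction on `n` with the words built by `Fin.snoc`
(`streamLen_snoc`, `card_pos_snoc`, `merge_snoc`, `prefix_snoc`, `tail_snoc`); when no block is
free and `⌊k/√2⌋ ≥ 1` the whole word is in merge order.  Part 5 reindexes an arbitrary word onto
such a word with the same sign counts.

What this is NOT: nothing on the crux (b = 2 OPEN, Chatterjee–Tengse §1.3 dir. 2) or `VP ≠ VNP`;
no definitions, no named facts, standard axioms.
Refs: Limaye–Srinivasan–Tavenas, J. ACM 72 (2025) Art. 26, §2.2 and Lemma 22.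
-/

-- `Summit.ValiantsHypothesis.ValiantsHypothesis.…` repeats a component (D-0017 layout); mandated.
set_option linter.dupNamespace false

noncomputable section

namespace Summit.ValiantsHypothesis.ValiantsHypothesis.Theorems.BarrierLeverDefinableEquations

open MvPolynomial
open Literature.Computability.AlgebraicComplexity
open Literature.Computability.AlgebraicComplexity.LSTWord
open scoped BigOperators

namespace ProductDepthWallTwo

/-! ## §7 Every sign count admits a word with a merge-ordered prefix and a free tail -/

section Exist

variable (k : ℕ)

/-- Appending a block does not change the earlier stream lengths. [cite: LimayeSrinivasanTavenas2025, §2.2] -/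
theorem streamLen_snoc {D : ℕ} (w : Fin D → Bool) (s s₁ : Bool) (t : ℕ) (ht : t ≤ D) :
    streamLen k (Fin.snoc w s : Fin (D + 1) → Bool) s₁ t = streamLen k w s₁ t := by
  rw [← streamLen_castSucc k (Fin.snoc w s : Fin (D + 1) → Bool) s₁ t ht]
  simp only [Fin.snoc_castSucc]

/-- The number of positive blocks after appending a block. [folklore] -/
theorem card_pos_snoc {D : ℕ} (w : Fin D → Bool) (s : Bool) :
    (Finset.univ.filter fun t : Fin (D + 1) => (Fin.snoc w s : Fin (D + 1) → Bool) t = true).card =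
      (Finset.univ.filter fun t : Fin D => w t = true).card + if s = true then 1 else 0 := by
  rw [Finset.card_filter, Finset.card_filter, Fin.sum_univ_castSucc]
  simp only [Fin.snoc_castSucc, Fin.snoc_last]

/-- The positive stream length is `#positive blocks · ⌊k/√2⌋`. [cite: LimayeSrinivasanTavenas2025, §2.2] -/
theorem streamLen_true_top {D : ℕ} (w : Fin D → Bool) :
    streamLen k w true D = (Finset.univ.filter fun t : Fin D => w t = true).card * posLetter k := by
  rw [streamLen_eq_sum k w true D le_rfl]
  have hf : (Finset.univ.filter fun i : Fin D => (i : ℕ) < D ∧ w i = true) =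
      Finset.univ.filter fun t : Fin D => w t = true := by
    ext i; simp
  rw [hf]
  calc ∑ i ∈ Finset.univ.filter (fun t : Fin D => w t = true), letterSize k w i
      = ∑ _i ∈ Finset.univ.filter (fun t : Fin D => w t = true), posLetter k :=
        Finset.sum_congr rfl fun i hi => by
          rw [Finset.mem_filter] at hi; simp [letterSize, hi.2]
    _ = _ := by rw [Finset.sum_const, smul_eq_mul]

/-- The negative stream length is `#negative blocks · k`. [cite: LimayeSrinivasanTavenas2025, §2.2] -/
theorem streamLen_false_top {D : ℕ} (w : Fin D → Bool) :
    streamLen k w false D = (D - (Finset.univ.filter fun t : Fin D => w t = true).card) * k := by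
  rw [streamLen_eq_sum k w false D le_rfl]
  have hf : (Finset.univ.filter fun i : Fin D => (i : ℕ) < D ∧ w i = false) =
      Finset.univ.filter fun t : Fin D => ¬ (w t = true) := by
    ext i; simp
  rw [hf]
  calc ∑ i ∈ Finset.univ.filter (fun t : Fin D => ¬ (w t = true)), letterSize k w i
      = ∑ _i ∈ Finset.univ.filter (fun t : Fin D => ¬ (w t = true)), k :=
        Finset.sum_congr rfl fun i hi => by
          rw [Finset.mem_filter] at hi; simp [letterSize, hi.2]
    _ = _ := by
        rw [Finset.sum_const, smul_eq_mul, Finset.filter_not,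
          Finset.card_sdiff_of_subset (Finset.filter_subset _ _), Finset.card_univ, Fintype.card_fin]

/-- Appending a block in merge position to a word in merge order keeps merge order.
[cite: LimayeSrinivasanTavenas2025, Lemma 22] -/
theorem merge_snoc {D : ℕ} (w : Fin D → Bool) (s : Bool)
    (hold : ∀ t : Fin D, streamLen k w (w t) t ≤ streamLen k w (!w t) t)
    (hnew : streamLen k w s D ≤ streamLen k w (!s) D) (t : Fin (D + 1)) :
    streamLen k (Fin.snoc w s : Fin (D + 1) → Bool) ((Fin.snoc w s : Fin (D + 1) → Bool) t) t ≤
      streamLen k (Fin.snoc w s : Fin (D + 1) → Bool) (!(Fin.snoc w s : Fin (D + 1) → Bool) t) t := by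
  rw [streamLen_snoc k w s _ t (Nat.le_of_lt_succ t.2), streamLen_snoc k w s _ t (Nat.le_of_lt_succ t.2)]
  induction t using Fin.lastCases with
  | last => simpa only [Fin.snoc_last, Fin.val_last] using hnew
  | cast i => simpa only [Fin.snoc_castSucc, Fin.val_castSucc] using hold i

/-- Appending any block keeps the conditions on a prefix. [folklore] -/
theorem prefix_snoc {D : ℕ} (w : Fin D → Bool) (s : Bool) {d' : ℕ} (hd : d' ≤ D)
    (hold : ∀ t : Fin D, (t : ℕ) < d' → streamLen k w (w t) t ≤ streamLen k w (!w t) t)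
    (hℓ : ∀ t : Fin D, (t : ℕ) < d' → 1 ≤ letterSize k w t) (t : Fin (D + 1)) (ht : (t : ℕ) < d') :
    streamLen k (Fin.snoc w s : Fin (D + 1) → Bool) ((Fin.snoc w s : Fin (D + 1) → Bool) t) t ≤
      streamLen k (Fin.snoc w s : Fin (D + 1) → Bool) (!(Fin.snoc w s : Fin (D + 1) → Bool) t) t ∧
    1 ≤ letterSize k (Fin.snoc w s : Fin (D + 1) → Bool) t := by
  rw [streamLen_snoc k w s _ t (Nat.le_of_lt_succ t.2), streamLen_snoc k w s _ t (Nat.le_of_lt_succ t.2)]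
  induction t using Fin.lastCases with
  | last => exact absurd ht (by simp; omega)
  | cast i =>
    rw [Fin.val_castSucc] at ht ⊢
    refine ⟨by simpa only [Fin.snoc_castSucc] using hold i ht, ?_⟩
    have := hℓ i ht
    unfold letterSize at this ⊢
    simpa only [Fin.snoc_castSucc] using this

/-- Appending a FREE block (longer-or-equal side, or no bits) keeps the free-tail condition.
[folklore] -/
theorem tail_snoc {D : ℕ} (w : Fin D → Bool) (s : Bool) {d' : ℕ}
    (hold : ∀ t : Fin D, d' ≤ (t : ℕ) →
      streamLen k w (!w t) t ≤ streamLen k w (w t) t ∨ letterSize k w t = 0)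
    (hnew : streamLen k w (!s) D ≤ streamLen k w s D ∨ (if s then posLetter k else k) = 0)
    (t : Fin (D + 1)) (ht : d' ≤ (t : ℕ)) :
    streamLen k (Fin.snoc w s : Fin (D + 1) → Bool) (!(Fin.snoc w s : Fin (D + 1) → Bool) t) t ≤
      streamLen k (Fin.snoc w s : Fin (D + 1) → Bool) ((Fin.snoc w s : Fin (D + 1) → Bool) t) t ∨
    letterSize k (Fin.snoc w s : Fin (D + 1) → Bool) t = 0 := by
  rw [streamLen_snoc k w s _ t (Nat.le_of_lt_succ t.2), streamLen_snoc k w s _ t (Nat.le_of_lt_succ t.2)]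
  induction t using Fin.lastCases with
  | last =>
    unfold letterSize
    simpa only [Fin.snoc_last, Fin.val_last] using hnew
  | cast i =>
    rw [Fin.val_castSucc] at ht ⊢
    have := hold i ht
    unfold letterSize at this ⊢
    simpa only [Fin.snoc_castSucc] using this

/-- **Existence of merge-ordered words.**  For all sign counts `p + q = n` there is a word with
`p` positive blocks consisting of a PREFIX IN MERGE ORDER (each block appended to the
shorter-or-equal stream, letters `≥ 1`) followed by FREE blocks (each on the longer-or-equal
side, or without bits); and if no block of either sign starts at or beyond the other stream's
total length ("no free block") and `⌊k/√2⌋ ≥ 1`, a word ENTIRELY in merge order.  (Backward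
greedy construction: peel a free block if there is one, else the block with the larger start.)
[cite: LimayeSrinivasanTavenas2025, Lemma 22] -/
theorem exists_mergeWord : ∀ n p q : ℕ, p + q = n →
    (∃ w : Fin n → Bool, (Finset.univ.filter fun t : Fin n => w t = true).card = p ∧
      ∃ d' : ℕ, d' ≤ n ∧
        (∀ t : Fin n, (t : ℕ) < d' → streamLen k w (w t) t ≤ streamLen k w (!w t) t) ∧
        (∀ t : Fin n, (t : ℕ) < d' → 1 ≤ letterSize k w t) ∧
        (∀ t : Fin n, d' ≤ (t : ℕ) →
          streamLen k w (!w t) t ≤ streamLen k w (w t) t ∨ letterSize k w t = 0)) ∧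
    (1 ≤ posLetter k → (1 ≤ p → (p - 1) * posLetter k < q * k) →
      (1 ≤ q → (q - 1) * k < p * posLetter k) →
      ∃ w : Fin n → Bool, (Finset.univ.filter fun t : Fin n => w t = true).card = p ∧
        ∀ t : Fin n, streamLen k w (w t) t ≤ streamLen k w (!w t) t) := by
  intro n
  induction n using Nat.strong_induction_on with
  | _ n IH =>
  intro p q hpq
  rcases n with _ | m
  · -- the empty word
    have hp : p = 0 := by omega
    subst hp
    refine ⟨⟨fun t => t.elim0, by simp, 0, le_rfl, fun t => t.elim0, fun t => t.elim0,
      fun t => t.elim0⟩, fun _ _ _ => ⟨fun t => t.elim0, by simp, fun t => t.elim0⟩⟩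
  have hαk : posLetter k ≤ k := posLetter_le k
  -- part (ii) first: words entirely in merge order when there is no free block
  have part2 : 1 ≤ posLetter k → (1 ≤ p → (p - 1) * posLetter k < q * k) →
      (1 ≤ q → (q - 1) * k < p * posLetter k) →
      ∃ w : Fin (m + 1) → Bool, (Finset.univ.filter fun t : Fin (m + 1) => w t = true).card = p ∧
        ∀ t : Fin (m + 1), streamLen k w (w t) t ≤ streamLen k w (!w t) t := by
    intro hα h1 h2
    have hp : 1 ≤ p := by
      by_contra hp
      have hq : 1 ≤ q := by omega
      have := h2 hq
      have hp0 : p = 0 := by omega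
      rw [hp0, zero_mul] at this
      exact absurd this (Nat.not_lt_zero _)
    have hq : 1 ≤ q := by
      by_contra hq
      have := h1 hp
      have hq0 : q = 0 := by omega
      rw [hq0, zero_mul] at this
      exact absurd this (Nat.not_lt_zero _)
    rcases lt_trichotomy ((q - 1) * k) ((p - 1) * posLetter k) with hlt | heq | hgt
    · -- the last positive block starts last: peel it (a compare)
      obtain ⟨w₀, hc₀, hm₀⟩ := (IH m (by omega) (p - 1) q (by omega)).2 hα
        (fun hp' => by
          have := h1 hp
          have : (p - 1 - 1) * posLetter k ≤ (p - 1) * posLetter k := Nat.mul_le_mul_right _ (by omega)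
          omega)
        (fun _ => hlt)
      refine ⟨Fin.snoc w₀ true, by rw [card_pos_snoc, hc₀, if_pos rfl]; omega, ?_⟩
      refine merge_snoc k w₀ true hm₀ ?_
      rw [Bool.not_true, streamLen_true_top, streamLen_false_top, hc₀]
      have := h1 hp
      have hq' : m - (p - 1) = q := by omega
      rw [hq']; omega
    · -- tie: peel the last negative block, then the last positive block
      rcases m with _ | m'
      · omega
      obtain ⟨w₀, hc₀, hm₀⟩ := (IH m' (by omega) (p - 1) (q - 1) (by omega)).2 hα
        (fun hp' => by
          have : (p - 1 - 1) * posLetter k < (p - 1) * posLetter k :=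
            Nat.mul_lt_mul_of_pos_right (by omega) hα
          omega)
        (fun hq' => by
          have : (q - 1 - 1) * k < (q - 1) * k := Nat.mul_lt_mul_of_pos_right (by omega) (by omega)
          omega)
      have hm₁ := merge_snoc k w₀ true hm₀ (by
        rw [Bool.not_true, streamLen_true_top, streamLen_false_top, hc₀]
        have hq' : m' - (p - 1) = q - 1 := by omega
        rw [hq']; omega)
      have hc₁ : (Finset.univ.filter fun t : Fin (m' + 1) =>
          (Fin.snoc w₀ true : Fin (m' + 1) → Bool) t = true).card = p := by
        rw [card_pos_snoc, hc₀, if_pos rfl]; omega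
      refine ⟨Fin.snoc (Fin.snoc w₀ true) false, by rw [card_pos_snoc, hc₁]; simp, ?_⟩
      refine merge_snoc k _ false hm₁ ?_
      rw [Bool.not_false, streamLen_true_top, streamLen_false_top, hc₁]
      have hq' : m' + 1 - p = q - 1 := by omega
      rw [hq']
      have : (p - 1) * posLetter k ≤ p * posLetter k := Nat.mul_le_mul_right _ (by omega)
      omega
    · -- the last negative block starts last: peel it
      obtain ⟨w₀, hc₀, hm₀⟩ := (IH m (by omega) p (q - 1) (by omega)).2 hα (fun _ => hgt)
        (fun hq' => by
          have := h2 hq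
          have : (q - 1 - 1) * k ≤ (q - 1) * k := Nat.mul_le_mul_right _ (by omega)
          omega)
      refine ⟨Fin.snoc w₀ false, by rw [card_pos_snoc, hc₀]; simp, ?_⟩
      refine merge_snoc k w₀ false hm₀ ?_
      rw [Bool.not_false, streamLen_true_top, streamLen_false_top, hc₀]
      have := h2 hq
      have hq' : m - p = q - 1 := by omega
      rw [hq']; omega
  refine ⟨?_, part2⟩
  -- part (i)
  by_cases hfree : (1 ≤ posLetter k ∧ (1 ≤ p → (p - 1) * posLetter k < q * k) ∧
      (1 ≤ q → (q - 1) * k < p * posLetter k))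
  · obtain ⟨w, hc, hm⟩ := part2 hfree.1 hfree.2.1 hfree.2.2
    refine ⟨w, hc, m + 1, le_rfl, fun t _ => hm t, fun t _ => ?_, fun t ht => absurd t.2 (by omega)⟩
    unfold letterSize
    split_ifs
    · exact hfree.1
    · exact hfree.1.trans hαk
  -- there is a free block: peel it
  have hcase : (1 ≤ p ∧ (q * k ≤ (p - 1) * posLetter k ∨ posLetter k = 0)) ∨
      (1 ≤ q ∧ p * posLetter k ≤ (q - 1) * k) := by
    by_cases hα : posLetter k = 0
    · by_cases hp : 1 ≤ p
      · exact Or.inl ⟨hp, Or.inr hα⟩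
      · right
        refine ⟨by omega, ?_⟩
        rw [hα, mul_zero]; exact Nat.zero_le _
    · have hα1 : 1 ≤ posLetter k := Nat.one_le_iff_ne_zero.2 hα
      by_cases hA : (1 ≤ p → (p - 1) * posLetter k < q * k)
      · have hB : ¬ (1 ≤ q → (q - 1) * k < p * posLetter k) := fun hB => hfree ⟨hα1, hA, hB⟩
        push Not at hB
        exact Or.inr hB
      · push Not at hA
        exact Or.inl ⟨hA.1, Or.inl hA.2⟩
  rcases hcase with ⟨hp, h⟩ | ⟨hq, h⟩
  · obtain ⟨w₀, hc₀, d', hd', hm₀, hℓ₀, ht₀⟩ := (IH m (by omega) (p - 1) q (by omega)).1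
    refine ⟨Fin.snoc w₀ true, by rw [card_pos_snoc, hc₀, if_pos rfl]; omega, d', by omega,
      fun t ht => (prefix_snoc k w₀ true hd' hm₀ hℓ₀ t ht).1,
      fun t ht => (prefix_snoc k w₀ true hd' hm₀ hℓ₀ t ht).2, tail_snoc k w₀ true ht₀ ?_⟩
    rw [if_pos rfl, Bool.not_true, streamLen_true_top, streamLen_false_top, hc₀]
    have hq' : m - (p - 1) = q := by omega
    rw [hq']
    rcases h with h | h
    · exact Or.inl h
    · exact Or.inr h
  · obtain ⟨w₀, hc₀, d', hd', hm₀, hℓ₀, ht₀⟩ := (IH m (by omega) p (q - 1) (by omega)).1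
    refine ⟨Fin.snoc w₀ false, by rw [card_pos_snoc, hc₀]; simp, d', by omega,
      fun t ht => (prefix_snoc k w₀ false hd' hm₀ hℓ₀ t ht).1,
      fun t ht => (prefix_snoc k w₀ false hd' hm₀ hℓ₀ t ht).2, tail_snoc k w₀ false ht₀ ?_⟩
    rw [Bool.not_false, streamLen_true_top, streamLen_false_top, hc₀]
    have hq' : m - p = q - 1 := by omega
    rw [hq']
    exact Or.inl h

end Exist

end ProductDepthWallTwo

end Summit.ValiantsHypothesis.ValiantsHypothesis.Theorems.BarrierLeverDefinableEquations
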